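import Summits.QuantumFields.YangMills.Theorems.BalabanUVNodesN12TowerSiteGraphConnectedNested
import Summits.QuantumFields.YangMills.Theorems.BalabanUVNodesN12Thm1EUAtFlatDatumAllIndices
import HarnessLib

/-!
# BalabanUVNodes ∕ N12 — THE TOWER-SITE CONSTRAINT GRAPH IS CONNECTED FOR EVERY SEPARATED (2.18) INDEX OF RECORD: `…N12TowerSiteGraphConnectedNested` §3 read at
# `Ω := s.Ω`, `s : Node00.SeqOfRecord F ν M g K k` with NODE 00's separation — (N) from r11's `Chain21`, (B)(S) from the lane's `…N12Thm1EUAtFlatDatumAllIndices` §1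

[Balaban1988Convergent] = «[III]», (2.1) p. 254, (2.2) p. 255, (2.18) p. 257; [Balaban1985RegularSpaces] = «[6]», (1.3)–(1.6) p. 77; [Balaban1985Variational] = «[15]», Thm 1 p. 279,
(3)–(4) p. 278.

Cell `pub-ymgap` (HUMAN RULINGS D-0062 ∕ D-0149), WIDTH SEAT `pub-ymgap-dag-n12-w6` g22 (node N12 = [B15]; key K1⁹ `stmt-QuantumFields-27364`, `--kind proof --supports … --as helper`;
count-neutral).  THEOREMS ONLY (0 `def`, 0 `instance`, 0 `sorry`); two `exact`s BY NAME: this seat's `…N12TowerSiteGraphConnectedNested.towerSite_mem_of_closed_genSet` (connectivity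
for every (N)(B)(S) sequence) fed by r11's `Chain21.Ω_succ_subset_Ω` ((N)) and the lane's (dag-n12-c g30) `…N12Thm1EUAtFlatDatumAllIndices.isBlockUnion_seq` ∕ `pow_dvd_dCubeSide`
((B): def-R's cube classes `DOfRecord` have side `LʲMR_j`) ∕ `sep_of_seqSeparated` ((S) from `Node00.Sect2.SeqSeparated ν.M₁ s`, `1 ≤ ν.M₁`).

WHY.  The (E∕U) NAME `B11Thm1ExistsUniqueCoP7M(G).VariationalThm1EUSep{Top,CoP}7M(G)` (✓p740853 ∕ ✓p742279) quantifies EVERY separated (2.18) index of record; dag-n12-w1 g4's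
`N12Thm1CentralLetterTwistObstruction.not_T1central_flat_of_disconnected` (p645205) refutes its tower-central uniqueness clause at the flat datum from DISCONNECTION DATA
`(T, hT, hz₁, hz₂)` of the tower-site constraint graph.  dag-n12-c g30's audit (i) (pub-ymgap INBOX 2026-08-29T20:07:47Z): «for EVERY separated index 𝒢(s) is CONNECTED … NOT typed for
general s»; the piece WORDED to w6 (INBOX 2026-08-29T20:30:17Z).  THIS FILE is that sentence as a kernel theorem in the twist file's own currency.

CONTENTS (namespace `Summit.QuantumFields.YangMills.BalabanUVNodes.N12TowerSiteGraphConnectedNestedOfRecord`): ★★★ `towerSite_mem_of_closed_genSet_of_seqSeparated`, ★★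
`not_disconnected_towerSiteGraph_of_seqSeparated`.

HONEST FRAMING.  A located PRECONDITION (graph connectivity) of the uniqueness clause, discharged for every separated index — NOT [15] Thm 1 and NOT a producer of the (E∕U) name
([15] Sects. C–G = N07∕NODE 00 mathematics); nothing of Bałaban's estimates asserted or refuted; count-neutral helper; N12 NOT discharged; K0⁷∕K1⁹ NOT closed; counts of record
unmoved; one finite 𝕋⁴ programme at fixed ε — R4 closes the conditional rung `BalabanLadder.UV` only; the Yang–Mills mass gap (Clay) is NOT proved by any of this; nothing continuum ∕
ℝ⁴ ∕ OS.
-/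

namespace Summit.QuantumFields.YangMills.BalabanUVNodes.N12TowerSiteGraphConnectedNestedOfRecord

open Set
open Literature.MathematicalPhysics.QuantumFieldTheory.Balaban1983to89
open Literature.MathematicalPhysics.QuantumFieldTheory.Balaban1983to89.Node00 (SeqOfRecord DOfRecord dCubeSide RkOfRecord Stage7Numerics)
open B15DeterminingSets (DetSet pts mem_pts bondsOf embIter genSet)
open Summit.QuantumFields.YangMills.BalabanUVNodes.N12TowerSiteGraphConnectedNested (towerSite_mem_of_closed_genSet)
open Summit.QuantumFields.YangMills.BalabanUVNodes.N12Thm1EUAtFlatDatumAllIndices (isBlockUnion_seq sep_of_seqSeparated pow_dvd_dCubeSide)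

/-! ## Every SEPARATED (2.18) index of record: (N) from r11's `Chain21`, (B)(S) from the lane's `…N12Thm1EUAtFlatDatumAllIndices` §1 -/

/-- ★★★ **THE TOWER-SITE CONSTRAINT GRAPH OF `genSet s.Ω k` IS CONNECTED FOR EVERY SEPARATED (2.18) INDEX OF RECORD** — the determining sets the (E∕U) name
`B11Thm1ExistsUniqueCoP7M(G).VariationalThm1EUSep…7M(G)` quantifies: numerics `ν` with `1 ≤ ν.M₁`, cube letter `M`, history `g`, torus `K`, length `0 < k ≤ m + K`, index
`s : Node00.SeqOfRecord F ν M g K k` (r11's `Chain21` ⇒ (N); def-R's cube classes of side `LʲMR_j` ⇒ (B)) with NODE 00's separation `Sect2.SeqSeparated ν.M₁ s` (⇒ (S)): a set `T` of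
fine sites closed under the constrained bonds containing ONE tower site contains ALL of them.
[cite: Balaban1988Convergent, (2.1) p.254, (2.2) p.255, (2.18) p.257; Balaban1985RegularSpaces, (1.3)–(1.6) p.77; Balaban1985Variational, Thm 1 p.279, (3)–(4) p.278] -/
theorem towerSite_mem_of_closed_genSet_of_seqSeparated {F : T4Continuum.T4Family} (ν : Stage7Numerics) (M : ℕ) (g : ℕ → ℝ) (K : ℕ) {k : ℕ}
    (s : SeqOfRecord F ν M g K k) (hk1 : 1 ≤ k) (hk : k ≤ (F.P K).m + (F.P K).K) (hM : 1 ≤ ν.M₁) (hsepS : Node00.Sect2.SeqSeparated ν.M₁ s)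
    (T : Set (Site (F.P K) 0)) (hT : ∀ j, j ≤ k → ∀ c ∈ bondsOf (genSet s.Ω k j), (embIter j c.src ∈ T ↔ embIter j c.tgt ∈ T))
    {j₁ : ℕ} (hj₁ : j₁ ≤ k) {c₁ : PBond (F.P K) j₁} (hc₁ : c₁ ∈ bondsOf (genSet s.Ω k j₁)) (hz₁ : embIter j₁ c₁.src ∈ T)
    {j₂ : ℕ} (hj₂ : j₂ ≤ k) {c₂ : PBond (F.P K) j₂} (hc₂ : c₂ ∈ bondsOf (genSet s.Ω k j₂)) : embIter j₂ c₂.src ∈ T :=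
  towerSite_mem_of_closed_genSet hk1 hk (fun _ h1 hj => s.chain.Ω_succ_subset_Ω h1 hj)
    (isBlockUnion_seq (D := DOfRecord F ν M g K) (σ := fun j => dCubeSide (F.P K).L M (RkOfRecord (F.P K).L ν.r (g j)) j) (fun _ => subset_rfl)
      (fun j => pow_dvd_dCubeSide _ _ _ j) hk s)
    (sep_of_seqSeparated hM hk hsepS) T hT hj₁ hc₁ hz₁ hj₂ hc₂

/-- ★★ **THE TWIST OBSTRUCTION's PREMISE SET IS EMPTY FOR EVERY SEPARATED (2.18) INDEX OF RECORD**: no set of fine sites closed under the constrained bonds of `genSet s.Ω k`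
separates two tower sites (`0 < k ≤ m + K`, `1 ≤ ν.M₁`, `Sect2.SeqSeparated ν.M₁ s`) — dag-n12-w1's `N12Thm1CentralLetterTwistObstruction.not_T1central_flat_of_disconnected`
cannot be armed against the (E∕U) name's uniqueness clause at any index it quantifies. [cite: Balaban1988Convergent, (2.1) p.254, (2.2) p.255, (2.18) p.257; Balaban1985RegularSpaces, (1.3)–(1.6) p.77; Balaban1985Variational, Thm 1 p.279, (3)–(4) p.278] -/
theorem not_disconnected_towerSiteGraph_of_seqSeparated {F : T4Continuum.T4Family} (ν : Stage7Numerics) (M : ℕ) (g : ℕ → ℝ) (K : ℕ) {k : ℕ}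
    (s : SeqOfRecord F ν M g K k) (hk1 : 1 ≤ k) (hk : k ≤ (F.P K).m + (F.P K).K) (hM : 1 ≤ ν.M₁) (hsepS : Node00.Sect2.SeqSeparated ν.M₁ s) :
    ¬ ∃ (T : Set (Site (F.P K) 0)) (j₁ : ℕ) (c₁ : PBond (F.P K) j₁) (j₂ : ℕ) (c₂ : PBond (F.P K) j₂),
        (∀ j, j ≤ k → ∀ c ∈ bondsOf (genSet s.Ω k j), (embIter j c.src ∈ T ↔ embIter j c.tgt ∈ T)) ∧
        j₁ ≤ k ∧ c₁ ∈ bondsOf (genSet s.Ω k j₁) ∧ embIter j₁ c₁.src ∈ T ∧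
        j₂ ≤ k ∧ c₂ ∈ bondsOf (genSet s.Ω k j₂) ∧ embIter j₂ c₂.src ∉ T := by
  rintro ⟨T, j₁, c₁, j₂, c₂, hT, hj₁, hc₁, hz₁, hj₂, hc₂, hz₂⟩
  exact hz₂ (towerSite_mem_of_closed_genSet_of_seqSeparated ν M g K s hk1 hk hM hsepS T hT hj₁ hc₁ hz₁ hj₂ hc₂)


end Summit.QuantumFields.YangMills.BalabanUVNodes.N12TowerSiteGraphConnectedNestedOfRecord
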